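import Literature.MathematicalPhysics.QuantumFieldTheory.Balaban1983to89.Beta.TransportVertices
import Mathlib.Analysis.SpecialFunctions.Exponential
import Mathlib.Analysis.Asymptotics.Lemmas

/-!
# `Balaban1983to89.Beta.LogHolonomySecondJet` — the log-free SECOND jet of the log-holonomy of a contour
# (B7 (114) «Y_x = (1/i) log V₀(Γ_{c,x} ∪ (−c))»): first jet = circulation, second jet = the path-ordering commutator sum, v1.0.1

HONEST FRAMING (page 1, mandatory).  This leaf belongs to the β sub-cell of the Bałaban audit, whose END STATEMENT is:
discharging the one-loop hypothesis `FlowStep.BetaPertH` (read at END-STATEMENT grade, RULING (R6)) makes Bałaban's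
ultraviolet stability theorem for 4-d lattice Yang–Mills ([Balaban1989LargeFieldII], Thm. 1 p. 355 (B16))
UNCONDITIONAL inside this package — a real constructive-QFT result; it is NOT the continuum limit and NOT the Clay
problem.  Gloss 2: EVERYTHING below is kernel-proved [folklore] asymptotic calculus in a complete normed algebra;
NOTHING is cited as a fact.  [Balaban1985Averaging] (= B7, CMP 98 (1985) 17–51) is quoted only to say WHICH object is
being typed (renders read as page images, PDF page = journal page − 16).

ABSOLUTE RULE (cell charter, verbatim; header line added v1.0.1 per beta-ref advisory A-R371, docstring-only): «No
internally-minted statement may enter as a cited fact. Every hypothesis is either kernel-proved in this package or a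
verbatim quotation of a PUBLISHED theorem with page reference. The manuscript(s) under audit are NOT citable for their
own disputed steps — they are the thing under adjudication; programme-internal (2001/route/tribunal) claims are never
citable.»  Accordingly NO declaration below is a `def … : Prop` carrying a citation and no hypothesis of any theorem is
a printed statement: every declaration is [folklore]; the quotations are object LOCATORS only.

WHAT IS BEING TYPED, AND WHY (node VH-STENCIL of the (V-H) brick, RULING (R18-3); `BETA/AN1.md` §26.6–§27).  The
«small» correction terms of Bałaban's one-step vector averaging B7 p.36 (124) are functional calculi of `ad_Y`, `ad_{Y_x}`
with B7 p.34 (114) «Y_x = (1/i) log V₀(Γ_{c,x} ∪ (−c))» — a LOGARITHM OF THE HOLONOMY of the background around a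
closed block contour.  For the first AND second `B`-jets of (124) at the trivial background `V₀ = e^{tB}` one needs
the first two Taylor coefficients of `t ↦ Y_x(t)`.  `Beta.AveragingCorrectionJets` §4 (node 4 of this seat, p186574)
typed the FIRST one log-free (`Ẏ = Σ l`, the circulation).  This leaf types BOTH log-free, by ASYMPTOTIC MATCHING:
if `Y` is ANY curve with a second-order expansion `Y t = t·S′ + t²·Q′ + o(t²)` at `0` and `exp (Y t) = holPath l t`
near `t = 0` (`holPath l t = Π_{b∈l} e^{t b}`, an2's `Beta.TransportVertices`), then
  `S′ = Σ l`  and  `Q′ = quad l − ½ (Σl)²`,  i.e.  `2·Q′ = commSum l = Σ_{i<j} [b_i, b_j]`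
(`log_holPath_jets`, `two_smul_secondCoeff_eq_commSum`): THE SECOND TAYLOR COEFFICIENT OF ANY LOCAL LOGARITHM OF THE
HOLONOMY IS HALF THE PATH-ORDERING COMMUTATOR SUM — the abelian part `(Σl)²` cancels exactly (`log(1 + tS + t²(S² +
C)/2 + O(t³)) = tS + t²C/2 + O(t³)`).  No logarithm is constructed, so no branch / `(1/i)` / Hermitian convention is
fixed; the statement is what the SECOND-order vector stencil of (124) consumes (the `g″(0) = ⅓`, `(g^{−1})″(0) = ⅙`
terms and the `ad_{Ÿ}` terms, `BETA/AN1.md` §27.4).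
INGREDIENTS, BY NAME (nothing restated): an2's `TransportVertices.norm_holonomy_sub_taylor_two_le'`
(`‖holonomy l − 1 − Σl − quad l‖ ≤ size³/6·e^{size}`), `sum_map_smul`, `quad_map_smul`, `size_map_smul`,
`two_smul_quad` (`2·quad l = (Σl)² + commSum l`), `holonomy_cons/nil`, `quad_cons/nil`, `size_cons/nil`; Mathlib's
asymptotics (`isLittleO_pow_pow`, `IsBigO.mul`, …).
CONTENT. §1 two elementary uniqueness lemmas for Taylor coefficients at `0` over an `RCLike` field
(`eq_zero_of_smul_pow_isLittleO`: `tⁿ·D = o(tⁿ) ⇒ D = 0`; `eq_zero_of_linear_quadratic_isLittleO`: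
`t·E + t²·D = o(t²) ⇒ E = 0 ∧ D = 0`); §2 the Taylor-two remainders of `exp` (one-letter case of an2's tail) and of
`holPath l` as `O(t³)`/`o(t²)` statements (`norm_exp_sub_taylor_two_le`, `norm_holPath_sub_taylor_two_le`,
`holPath_taylor_isBigO`, `exp_comp_taylor_isLittleO`); §3 the matching theorem and its corollaries (incl. the
first-jet-only version `log_holPath_firstCoeff`, consistent with `AveragingCorrectionJets.deriv_log_holPath_eq_sum`).
NOT HERE: everything listed under «NOT HERE» in `Beta.AveragingCorrectionJets`; in particular the block/contour
indexing and the packaging into an2's `OneStepResolventKernel.LocStencil`.  Nothing of B7 is asserted.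

Provenance: b2b-balaban β sub-cell, unit beta-an1 gen 10 (node 4b), 2026-08-19.  v1 = p186681
(71e3689e05b0); v1.0.1 (same day): DOCSTRING-ONLY — the ABSOLUTE RULE header line (beta-ref A-R371); no declaration
changed.  Bib keys: Balaban1985Averaging,
Balaban1989LargeFieldII.
-/

namespace Literature.MathematicalPhysics.QuantumFieldTheory.Balaban1983to89.Beta.LogHolonomySecondJet

open NormedSpace Filter Topology Asymptotics
open Literature.MathematicalPhysics.QuantumFieldTheory.Balaban1983to89.Beta.TransportVertices

noncomputable section

/-! ## §1 Uniqueness of Taylor coefficients at `0` -/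

section Uniqueness

variable {𝕜 : Type*} [RCLike 𝕜] {𝔸 : Type*} [NormedAddCommGroup 𝔸] [NormedSpace 𝕜 𝔸]

/-- [folklore] `t ↦ tⁿ·D` is `o(tⁿ)` at `0` only if `D = 0`. -/
theorem eq_zero_of_smul_pow_isLittleO {D : 𝔸} {n : ℕ}
    (h : (fun t : 𝕜 => t ^ n • D) =o[𝓝 (0 : 𝕜)] fun t => t ^ n) : D = 0 := by
  rw [isLittleO_iff] at h
  have key : ∀ c : ℝ, 0 < c → ‖D‖ ≤ c := by
    intro c hc
    have hev : ∀ᶠ t in 𝓝[≠] (0 : 𝕜), ‖t ^ n • D‖ ≤ c * ‖t ^ n‖ := nhdsWithin_le_nhds (h hc)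
    obtain ⟨t, ht, ht0⟩ := (hev.and self_mem_nhdsWithin).exists
    have htn : 0 < ‖t ^ n‖ := by
      rw [norm_pow]; exact pow_pos (norm_pos_iff.mpr ht0) n
    rw [norm_smul] at ht
    exact le_of_mul_le_mul_left (by linarith [ht]) htn
  have h0 : ‖D‖ ≤ 0 := by
    refine le_of_not_gt fun hlt => ?_
    have := key (‖D‖ / 2) (by linarith)
    linarith
  exact norm_le_zero_iff.mp h0

/-- [folklore] `t·E + t²·D = o(t²)` at `0` ⇒ `E = 0` and `D = 0` (uniqueness of the first two Taylor coefficients). -/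
theorem eq_zero_of_linear_quadratic_isLittleO {E D : 𝔸}
    (h : (fun t : 𝕜 => t • E + t ^ 2 • D) =o[𝓝 (0 : 𝕜)] fun t => t ^ 2) : E = 0 ∧ D = 0 := by
  have hD2 : (fun t : 𝕜 => t ^ 2 • D) =O[𝓝 (0 : 𝕜)] fun t => t ^ 2 :=
    IsBigO.of_bound ‖D‖ (Eventually.of_forall fun t => by rw [norm_smul, mul_comm])
  have h21 : (fun t : 𝕜 => t ^ 2) =o[𝓝 (0 : 𝕜)] fun t => t ^ 1 := isLittleO_pow_pow one_lt_two
  have hE : (fun t : 𝕜 => t ^ 1 • E) =o[𝓝 (0 : 𝕜)] fun t => t ^ 1 := by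
    have h1 : (fun t : 𝕜 => t • E + t ^ 2 • D) =o[𝓝 (0 : 𝕜)] fun t => t ^ 1 := h.trans_isBigO h21.isBigO
    have h2 : (fun t : 𝕜 => t ^ 2 • D) =o[𝓝 (0 : 𝕜)] fun t => t ^ 1 := hD2.trans_isLittleO h21
    exact (h1.sub h2).congr_left fun t => by simp
  have hE0 : E = 0 := eq_zero_of_smul_pow_isLittleO hE
  refine ⟨hE0, eq_zero_of_smul_pow_isLittleO (h.congr_left fun t => by simp [hE0])⟩

end Uniqueness

/-! ## §2 Taylor-two remainders of `exp` and of the holonomy path, as asymptotic statements -/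

section Taylor

variable (𝕜 : Type*) [RCLike 𝕜] {𝔸 : Type*} [NormedRing 𝔸] [NormedAlgebra 𝕜 𝔸] [CompleteSpace 𝔸]

/-- [folklore] The one-letter case of an2's holonomy tail: `‖e^Z − 1 − Z − ½Z²‖ ≤ ‖Z‖³/6 · e^{‖Z‖}`. -/
theorem norm_exp_sub_taylor_two_le (Z : 𝔸) :
    ‖exp Z - 1 - Z - (2 : 𝕜)⁻¹ • (Z * Z)‖ ≤ ‖Z‖ ^ 3 / 6 * Real.exp ‖Z‖ := by
  have h := norm_holonomy_sub_taylor_two_le' 𝕜 [Z]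
  simpa [holonomy_cons, holonomy_nil, quad_cons, quad_nil, size_cons, size_nil] using h

/-- [folklore] The holonomy path to second order: `‖holPath l t − 1 − t·Σl − t²·quad l‖ ≤ (‖t‖·size l)³/6 · e^{‖t‖·size l}`
(an2's tail on the rescaled letters `t·l`, with `sum_map_smul`, `quad_map_smul`, `size_map_smul`). -/
theorem norm_holPath_sub_taylor_two_le (l : List 𝔸) (t : 𝕜) :
    ‖holPath 𝕜 l t - 1 - t • l.sum - t ^ 2 • quad 𝕜 l‖
      ≤ (‖t‖ * size l) ^ 3 / 6 * Real.exp (‖t‖ * size l) := by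
  have h := norm_holonomy_sub_taylor_two_le' 𝕜 (l.map (t • ·))
  rw [sum_map_smul, quad_map_smul, size_map_smul] at h
  exact h

/-- [folklore] … hence `holPath l t − 1 − t·Σl − t²·quad l = O(t³)` at `t = 0`. -/
theorem holPath_taylor_isBigO (l : List 𝔸) :
    (fun t : 𝕜 => holPath 𝕜 l t - 1 - t • l.sum - t ^ 2 • quad 𝕜 l) =O[𝓝 (0 : 𝕜)] fun t => t ^ 3 := by
  refine IsBigO.of_bound (size l ^ 3 / 6 * Real.exp (size l)) ?_
  have hball : ∀ᶠ t : 𝕜 in 𝓝 0, ‖t‖ ≤ 1 := by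
    filter_upwards [Metric.closedBall_mem_nhds (0 : 𝕜) one_pos] with t ht
    simpa [dist_zero_right] using ht
  filter_upwards [hball] with t ht
  have hs := size_nonneg l
  have h1 : Real.exp (‖t‖ * size l) ≤ Real.exp (size l) :=
    Real.exp_le_exp.mpr (by nlinarith [norm_nonneg t])
  have h2 : (0 : ℝ) ≤ ‖t‖ ^ 3 * size l ^ 3 / 6 := by positivity
  calc ‖holPath 𝕜 l t - 1 - t • l.sum - t ^ 2 • quad 𝕜 l‖
      ≤ (‖t‖ * size l) ^ 3 / 6 * Real.exp (‖t‖ * size l) := norm_holPath_sub_taylor_two_le 𝕜 l t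
    _ = ‖t‖ ^ 3 * size l ^ 3 / 6 * Real.exp (‖t‖ * size l) := by ring
    _ ≤ ‖t‖ ^ 3 * size l ^ 3 / 6 * Real.exp (size l) := mul_le_mul_of_nonneg_left h1 h2
    _ = size l ^ 3 / 6 * Real.exp (size l) * ‖t ^ 3‖ := by rw [norm_pow]; ring

/-- [folklore] Along a curve `Y = O(t)` with `Y → 0`: `e^{Y t} − 1 − Y t − ½(Y t)² = o(t²)` at `t = 0`. -/
theorem exp_comp_taylor_isLittleO {Y : 𝕜 → 𝔸} (hY : Y =O[𝓝 (0 : 𝕜)] fun t => t)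
    (hY0 : Tendsto Y (𝓝 0) (𝓝 0)) :
    (fun t => exp (Y t) - 1 - Y t - (2 : 𝕜)⁻¹ • (Y t * Y t)) =o[𝓝 (0 : 𝕜)] fun t => t ^ 2 := by
  have hsmall : ∀ᶠ t in 𝓝 (0 : 𝕜), ‖Y t‖ ≤ 1 := by
    have h1 : ∀ᶠ y in 𝓝 (0 : 𝔸), ‖y‖ ≤ 1 := by
      filter_upwards [Metric.closedBall_mem_nhds (0 : 𝔸) one_pos] with y hy
      simpa [dist_zero_right] using hy
    exact hY0.eventually h1
  have h1 : (fun t => exp (Y t) - 1 - Y t - (2 : 𝕜)⁻¹ • (Y t * Y t)) =O[𝓝 (0 : 𝕜)]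
      fun t => ‖Y t‖ ^ 3 := by
    refine IsBigO.of_bound (Real.exp 1 / 6) ?_
    filter_upwards [hsmall] with t ht
    have hexp : Real.exp ‖Y t‖ ≤ Real.exp 1 := Real.exp_le_exp.mpr ht
    have h0 : (0 : ℝ) ≤ ‖Y t‖ ^ 3 / 6 := by positivity
    calc ‖exp (Y t) - 1 - Y t - (2 : 𝕜)⁻¹ • (Y t * Y t)‖
        ≤ ‖Y t‖ ^ 3 / 6 * Real.exp ‖Y t‖ := norm_exp_sub_taylor_two_le 𝕜 (Y t)
      _ ≤ ‖Y t‖ ^ 3 / 6 * Real.exp 1 := mul_le_mul_of_nonneg_left hexp h0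
      _ = Real.exp 1 / 6 * ‖‖Y t‖ ^ 3‖ := by
          rw [Real.norm_of_nonneg (by positivity)]; ring
  have h2 : (fun t => ‖Y t‖ ^ 3) =O[𝓝 (0 : 𝕜)] fun t => ‖t‖ ^ 3 := hY.norm_norm.pow 3
  have h3 : (fun t : 𝕜 => ‖t‖ ^ 3) =O[𝓝 (0 : 𝕜)] fun t => t ^ 3 :=
    IsBigO.of_bound 1 (Eventually.of_forall fun t => by simp [norm_pow])
  have h4 : (fun t : 𝕜 => t ^ 3) =o[𝓝 (0 : 𝕜)] fun t => t ^ 2 := isLittleO_pow_pow (by norm_num)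
  exact ((h1.trans h2).trans h3).trans_isLittleO h4

end Taylor

/-! ## §3 The matching theorem: both Taylor coefficients of a local logarithm of the holonomy -/

section Matching

variable (𝕜 : Type*) [RCLike 𝕜] {𝔸 : Type*} [NormedRing 𝔸] [NormedAlgebra 𝕜 𝔸] [CompleteSpace 𝔸]

/-- [folklore] THE LOG-HOLONOMY JETS, LOG-FREE.  If `Y t = t·S′ + t²·Q′ + o(t²)` at `0` and `exp (Y t) = holPath l t`
near `0`, then `S′ = Σ l` and `Q′ = quad l − ½ S′²`. -/
theorem log_holPath_jets (l : List 𝔸) {Y : 𝕜 → 𝔸} {S' Q' : 𝔸}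
    (hY : (fun t => Y t - t • S' - t ^ 2 • Q') =o[𝓝 (0 : 𝕜)] fun t => t ^ 2)
    (hlog : ∀ᶠ t in 𝓝 (0 : 𝕜), exp (Y t) = holPath 𝕜 l t) :
    S' = l.sum ∧ Q' = quad 𝕜 l - (2 : 𝕜)⁻¹ • (S' * S') := by
  -- asymptotic bookkeeping at `𝓝 0`
  have ht21 : (fun t : 𝕜 => t ^ 2) =O[𝓝 (0 : 𝕜)] fun t => t :=
    ((isLittleO_pow_pow one_lt_two).congr_left (fun t => rfl)).isBigO.trans
      (IsBigO.of_bound 1 (Eventually.of_forall fun t => by simp))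
  have ht32 : (fun t : 𝕜 => t ^ 3) =o[𝓝 (0 : 𝕜)] fun t => t ^ 2 := isLittleO_pow_pow (by norm_num)
  have hQ2 : (fun t : 𝕜 => t ^ 2 • Q') =O[𝓝 (0 : 𝕜)] fun t => t ^ 2 :=
    IsBigO.of_bound ‖Q'‖ (Eventually.of_forall fun t => by rw [norm_smul, mul_comm])
  have hS1 : (fun t : 𝕜 => t • S') =O[𝓝 (0 : 𝕜)] fun t => t :=
    IsBigO.of_bound ‖S'‖ (Eventually.of_forall fun t => by rw [norm_smul, mul_comm])
  -- `Y − t·S′ = O(t²)`, `Y = O(t)`, `Y → 0`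
  have hYS : (fun t => Y t - t • S') =O[𝓝 (0 : 𝕜)] fun t => t ^ 2 :=
    (hY.isBigO.add hQ2).congr_left fun t => by simp only [sub_add_cancel]
  have hYO : Y =O[𝓝 (0 : 𝕜)] fun t => t :=
    ((hYS.trans ht21).add hS1).congr_left fun t => by simp only [sub_add_cancel]
  have hY0 : Tendsto Y (𝓝 0) (𝓝 0) := hYO.trans_tendsto tendsto_id
  -- the square: `Y·Y − t²·S′² = (Y − tS′)·Y + (tS′)·(Y − tS′) = O(t³) = o(t²)`
  have hsq : (fun t => Y t * Y t - t ^ 2 • (S' * S')) =o[𝓝 (0 : 𝕜)] fun t => t ^ 2 := by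
    have h1 : (fun t => (Y t - t • S') * Y t) =O[𝓝 (0 : 𝕜)] fun t => t ^ 2 * t := hYS.mul hYO
    have h2 : (fun t => (t • S') * (Y t - t • S')) =O[𝓝 (0 : 𝕜)] fun t => t * t ^ 2 := hS1.mul hYS
    have h3 : (fun t => (Y t - t • S') * Y t + (t • S') * (Y t - t • S')) =O[𝓝 (0 : 𝕜)] fun t => t ^ 3 :=
      (h1.congr (fun t => rfl) (fun t => by ring)).add (h2.congr (fun t => rfl) (fun t => by ring))
    refine (h3.trans_isLittleO ht32).congr_left fun t => ?_
    simp only [sub_mul, mul_sub, smul_mul_assoc, mul_smul_comm, smul_smul, pow_two]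
    abel
  -- the two Taylor remainders
  have hE1 := exp_comp_taylor_isLittleO 𝕜 hYO hY0
  have hE2 : (fun t : 𝕜 => holPath 𝕜 l t - 1 - t • l.sum - t ^ 2 • quad 𝕜 l) =o[𝓝 (0 : 𝕜)] fun t => t ^ 2 :=
    (holPath_taylor_isBigO 𝕜 l).trans_isLittleO ht32
  -- `exp ∘ Y − holPath l = 0` near `0`
  have h0 : (fun t => exp (Y t) - holPath 𝕜 l t) =o[𝓝 (0 : 𝕜)] fun t => t ^ 2 := by
    refine (isLittleO_zero (fun t : 𝕜 => t ^ 2) (𝓝 (0 : 𝕜))).congr' ?_ EventuallyEq.rfl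
    filter_upwards [hlog] with t ht
    simp [ht]
  -- assemble: the polynomial part is `o(t²)`
  have hsq' : (fun t => (2 : 𝕜)⁻¹ • (Y t * Y t - t ^ 2 • (S' * S'))) =o[𝓝 (0 : 𝕜)] fun t => t ^ 2 :=
    (hsq.const_smul_left ((2 : 𝕜)⁻¹)).congr_left fun t => rfl
  have hpoly : (fun t : 𝕜 => t • (S' - l.sum) + t ^ 2 • (Q' + (2 : 𝕜)⁻¹ • (S' * S') - quad 𝕜 l))
      =o[𝓝 (0 : 𝕜)] fun t => t ^ 2 := by
    refine ((((h0.sub hE1).sub hY).sub hsq').add hE2).congr_left fun t => ?_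
    simp only [smul_sub, smul_add, smul_smul]
    module
  obtain ⟨h1, h2⟩ := eq_zero_of_linear_quadratic_isLittleO hpoly
  refine ⟨sub_eq_zero.mp h1, ?_⟩
  have : Q' + (2 : 𝕜)⁻¹ • (S' * S') = quad 𝕜 l := sub_eq_zero.mp h2
  rw [← this, add_sub_cancel_right]

/-- [folklore] COROLLARY: the second Taylor coefficient of any local logarithm of the holonomy is HALF THE PATH-ORDERING
COMMUTATOR SUM, `2·Q′ = commSum l = Σ_{i<j} [b_i, b_j]` — the abelian part `(Σl)²` cancels (an2's `two_smul_quad`). -/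
theorem two_smul_secondCoeff_eq_commSum (l : List 𝔸) {Y : 𝕜 → 𝔸} {S' Q' : 𝔸}
    (hY : (fun t => Y t - t • S' - t ^ 2 • Q') =o[𝓝 (0 : 𝕜)] fun t => t ^ 2)
    (hlog : ∀ᶠ t in 𝓝 (0 : 𝕜), exp (Y t) = holPath 𝕜 l t) :
    (2 : 𝕜) • Q' = commSum l := by
  obtain ⟨hS, hQ⟩ := log_holPath_jets 𝕜 l hY hlog
  rw [hQ, smul_sub, two_smul_quad, smul_smul, hS]
  have h2 : (2 : 𝕜) * (2 : 𝕜)⁻¹ = 1 := mul_inv_cancel₀ two_ne_zero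
  rw [h2, one_smul, add_sub_cancel_left]

/-- [folklore] For an ABELIAN family of letters (all `[b_i, b_j] = 0`, i.e. `commSum l = 0`) the second coefficient
vanishes: a local logarithm of `Π e^{t b_j} = e^{t Σ b_j}` is `t·Σl + o(t²)`. -/
theorem secondCoeff_eq_zero_of_commSum_eq_zero (l : List 𝔸) (hC : commSum l = 0) {Y : 𝕜 → 𝔸} {S' Q' : 𝔸}
    (hY : (fun t => Y t - t • S' - t ^ 2 • Q') =o[𝓝 (0 : 𝕜)] fun t => t ^ 2)
    (hlog : ∀ᶠ t in 𝓝 (0 : 𝕜), exp (Y t) = holPath 𝕜 l t) : Q' = 0 := by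
  have h := two_smul_secondCoeff_eq_commSum 𝕜 l hY hlog
  rw [hC] at h
  exact (smul_eq_zero.mp h).resolve_left two_ne_zero

/-- [folklore] FIRST-COEFFICIENT-ONLY version (consistent with `AveragingCorrectionJets.deriv_log_holPath_eq_sum`, which
assumes differentiability instead): `Y t = t·S′ + O(t²)`… here in the form `Y t − t·S′ − t²·Q′ = o(t²)` for SOME `Q′`. -/
theorem log_holPath_firstCoeff (l : List 𝔸) {Y : 𝕜 → 𝔸} {S' Q' : 𝔸}
    (hY : (fun t => Y t - t • S' - t ^ 2 • Q') =o[𝓝 (0 : 𝕜)] fun t => t ^ 2)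
    (hlog : ∀ᶠ t in 𝓝 (0 : 𝕜), exp (Y t) = holPath 𝕜 l t) : S' = l.sum :=
  (log_holPath_jets 𝕜 l hY hlog).1

/-- [folklore] SANITY (one letter): for `l = [b]` and the exact logarithm `Y t = t·b` the hypotheses hold with
`S′ = b`, `Q′ = 0`, and indeed `commSum [b] = 0`. -/
example (b : 𝔸) : (fun t : 𝕜 => t • b - t • b - t ^ 2 • (0 : 𝔸)) =o[𝓝 (0 : 𝕜)] fun t => t ^ 2 := by
  simp only [sub_self, smul_zero]
  exact isLittleO_zero _ _

/-- [folklore] SANITY (one letter, continued): `e^{t b} = holPath [b] t` for every `t`. -/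
example (b : 𝔸) : ∀ᶠ t in 𝓝 (0 : 𝕜), exp (t • b) = holPath 𝕜 [b] t :=
  Eventually.of_forall fun t => by simp [holPath_cons]

/-- [folklore] SANITY (one letter, continued): `commSum [b] = 0`, matching `Q′ = 0`. -/
example (b : 𝔸) : commSum [b] = 0 := by simp [commSum]

/-- [folklore] SANITY (two letters): `commSum [a, b] = a b − b a`, so a local logarithm of `e^{ta} e^{tb}` is
`t(a + b) + (t²/2)(ab − ba) + o(t²)` — the second-order Baker–Campbell–Hausdorff term. -/
example (a b : 𝔸) : commSum [a, b] = a * b - b * a := by simp [commSum]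

end Matching

end

end Literature.MathematicalPhysics.QuantumFieldTheory.Balaban1983to89.Beta.LogHolonomySecondJet
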